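import Summits.ABC.ABC.Theses.DefiniteXi
import Summits.ABC.ABC.Theorems.RibetTakahashiSplitWeightedSzpiroBoundForgivenDegreeBoundOfDefiniteXi
import Summits.ABC.ABC.Theorems.DefiniteXiMinimalBoundGivesTarget
import Summits.ABC.ABC.Theorems.DefiniteXiDegreeBoundToABCOfPetersson
import Summits.ABC.ABC.Theorems.DefiniteXiPolyFreyDegree
import Literature.NumberTheory.DiophantineGeometry.ConductorRadicalProofs
import HarnessLib

/-!
# Route DefiniteXi — support item `XiBoundUpgrade` (stmt-ABC-14722): the ladder glue, its logical
# position, and the prime-level form that the deciding theorem actually consumes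

Item `Summit.ABC.ABC.Theses.DefiniteXi.XiBoundUpgrade := XiBound → XiStrongBound` (support, rank 9)
wires the weak rung `XiBound` (stmt-ABC-11336: `∃ A C, ξ(E_{a,b}; N/N⁻, N⁻) ≤ C N^A`) into the cone of
the deciding theorem `closes`, which consumes the strong rung `XiStrongBound` (stmt-ABC-11337:
`∀ ε, ξ · ∏_{q ∣ N⁻} v_q(Δ_min) ≤ C_ε N^{2+ε}`).

## Status (prover analysis, 2026-08-16): OPEN, of abc strength; closes the day stmt-ABC-11337 does

* GIVEN `XiStrongBound` the item is `fun _ => h` (`xiBoundUpgrade_of_xiStrongBound`).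
* GIVEN only `XiBound` it is the upgrade "polynomial exponent `A` ↦ `2 + ε`, with the level-lowering
  factor `∏ v_q(Δ_min)`", i.e. polynomial Szpiro ⟹ sharp Szpiro on Frey curves — the same residual as
  the crux `SharpDegreeOfPolyDegree` of route `IsogenyGlueCongruence` (stmt-ABC-10895) read on the
  definite side; no amplification from a fixed exponent to `2 + ε` is known (no tensor-power /
  base-change trick on Frey triples over `ℚ`).  No formal shortcut either: on the whole domain a Brandt
  setup EXISTS (`Theorems/XiBound/Negative/XiBoundDomainSetup.lean`, `nonempty_xiSetup_freyCurve`), so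
  `brandtXi` is the genuine congruence number, never the junk `0`.
* NOT refutable cheaply: `¬ XiBoundUpgrade ↔ XiBound ∧ ¬ XiStrongBound` (`not_xiBoundUpgrade_iff`) —
  a disproof contains a PROOF of the open weak rung.

## What this file proves (complete proofs, no named-fact hypotheses)

* (A) `xiBoundUpgrade_of_xiStrongBound` — provability (i) of the item docstring.
* (B) `xiBound_of_xiStrongBound` — the CONVERSE rung `XiStrongBound → XiBound` with `A = 3`: every
  factor `v_q(Δ_min(E_{a,b}))`, `q ∣ N⁻ ∣ N`, is `≥ 1` because the conductor and the minimal
  discriminant have the same prime factors (`WeierstrassCurve.radical_conductorNorm_eq_holds`,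
  PROVED in the tree), so `ξ ≤ ξ · ∏ v_q ≤ C_1 N^3`.  Hence, given the item, the two cruxes are
  EQUIVALENT (`xiStrongBound_iff_xiBound`), and given the weak rung the item IS the strong rung
  (`xiBoundUpgrade_iff_xiStrongBound`).
* (C) `not_xiBoundUpgrade_iff` — the logical position of a refutation.
* (D) `freyDegreeBound_of_xiBound_of_xiBoundUpgrade`, `abc_of_xiBound_of_xiBoundUpgrade` — "`closes`
  is reached as `XiBound` + this item": with the PROVED items `DefiniteGlue`
  (`TwoAdicEisensteinAnchor.definiteGlue_holds`), `MinimalBoundGivesTarget`, `DegreeBoundToABCOfPetersson`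
  discharged, `XiBound → XiBoundUpgrade → DefiniteRTControlPrime → FreyModularity → FreyDegreeBound`
  and `… → PeterssonLowerBound → ABC`.
* (E) `minimalDegreeBound_of_primeXiStrongBound`, `abc_of_xiBound_of_primeUpgrade` — the deciding
  chain consumes the strong rung ONLY at `N⁻ = q` a single odd prime (`definiteGlue_holds` specialises
  `XiStrongBound` there), so the PRIME-LEVEL upgrade
  `XiBound → (∀ ε, ξ(E; N/q, q) · v_q(Δ_min) ≤ C_ε N^{2+ε} for odd primes q ∣ N)` already reaches
  `ABC` with the same supports; the composite-`N⁻` instances of the item (the corner named in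
  stmt-ABC-11337's "why it might fail": `N/N⁻ = 2^k`, `den γ ≤ κ^ω · D` only) are not load-bearing.
  Stated with the prime-level bound INLINE (no new definition; a planner may restate).

* (G) `xiBoundUpgrade_iff_not_xiBound_or_xiStrongBound` — the two events that close the item.  The
  companion file `DefiniteXiXiBoundUpgradeSharpening.lean` (H) shows that, given the known inputs, the
  level-lowering factor is `≤ N^ε` under the weak rung, so the item is the exponent sharpening of `ξ` alone.

## References

* D. W. Masser, *Note on a conjecture of Szpiro*, Astérisque 183 (1990) (A ≥ 2 is forced).
* H. Pasten, *Shimura curves and the abc conjecture*, J. Number Theory 254 (2024) = arXiv:1705.09251,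
  Thm 6.1, Thm 16.8.
* S. Takahashi, *Degrees of parametrizations of elliptic curves by Shimura curves*, J. Number Theory 90
  (2001), Thm 2.3, 3.8.
* R. Pollack, T. Weston, Compos. Math. 147 (2011), Thm 6.8.
-/

-- Summit.<Summit>.<Problem> is the mandated namespace; for the single-conjunct summit ABC the duplicate ABC.ABC is deliberate.
set_option linter.dupNamespace false

noncomputable section

namespace Summit.ABC.ABC.Theorems.DefiniteXiXiBoundUpgrade

open Literature.NumberTheory
open Literature.NumberTheory.Automorphic
open Literature.NumberTheory.EllipticCurves
open Literature.NumberTheory.EllipticCurves.ModularForms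
open Summit.ABC.ABC.Theses.DefiniteXi

/-! ## (A) The item from the strong rung -/

/-- **(A) `XiStrongBound → XiBoundUpgrade`**: the ladder glue is immediate from the strong rung (the
hypothesis `XiBound` is idle); the item closes the moment stmt-ABC-11337 does. [folklore] -/
theorem xiBoundUpgrade_of_xiStrongBound (h : XiStrongBound) : XiBoundUpgrade := fun _ => h

/-! ## (B) The converse rung `XiStrongBound → XiBound` -/

/-- At a prime factor `q` of a divisor `Nm` of the conductor `N` of the Frey curve `E_{a,b}`
(`ab(a+b) ≠ 0`), the minimal discriminant has `v_q(Δ_min) ≥ 1`: `N` and `|Δ_min|` have the same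
prime factors (`WeierstrassCurve.radical_conductorNorm_eq_holds`, Silverman AEC VIII.11). [folklore] -/
theorem one_le_factorization_minimalDiscriminantNorm_freyCurve {a b : ℤ} (h0 : a * b * (a + b) ≠ 0)
    {N : ℕ} [NeZero N] (hN : (freyCurve a b).conductorNorm ℤ = N) {Nm q : ℕ} (hNm : Nm ∣ N)
    (hq : q ∈ Nm.primeFactors) :
    1 ≤ ((freyCurve a b).minimalDiscriminantNorm ℤ).factorization q := by
  haveI := isElliptic_freyCurve h0
  have hpf : ((freyCurve a b).conductorNorm ℤ).primeFactors =
      ((freyCurve a b).minimalDiscriminantNorm ℤ).primeFactors := by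
    rw [← Nat.primeFactors_radical, (freyCurve a b).radical_conductorNorm_eq_holds,
      Nat.primeFactors_radical]
  have hqN : q ∈ ((freyCurve a b).conductorNorm ℤ).primeFactors := by
    rw [hN]
    exact Nat.primeFactors_mono hNm (NeZero.ne N) hq
  rw [hpf] at hqN
  obtain ⟨hqp, hqd, hne⟩ := Nat.mem_primeFactors.mp hqN
  exact hqp.factorization_pos_of_dvd hne hqd

/-- The level-lowering factor `∏_{q ∣ N⁻} v_q(Δ_min(E_{a,b}))` of `XiStrongBound` is `≥ 1` on the
domain of the cruxes (`N⁻ ∣ N`; each factor is `≥ 1`). [folklore] -/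
theorem one_le_prod_factorization_minimalDiscriminantNorm_freyCurve {a b : ℤ}
    (h0 : a * b * (a + b) ≠ 0) {N : ℕ} [NeZero N] (hN : (freyCurve a b).conductorNorm ℤ = N)
    {Nm : ℕ} (hNm : Nm ∣ N) :
    (1 : ℝ) ≤ ∏ q ∈ Nm.primeFactors,
      ((((freyCurve a b).minimalDiscriminantNorm ℤ).factorization q : ℕ) : ℝ) := by
  rw [← Nat.cast_prod, Nat.one_le_cast, Nat.one_le_iff_ne_zero, Finset.prod_ne_zero_iff]
  intro q hq
  exact Nat.one_le_iff_ne_zero.mp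
    (one_le_factorization_minimalDiscriminantNorm_freyCurve h0 hN hNm hq)

/-- **(B) The converse rung `XiStrongBound → XiBound`** (exponent `A = 3`, constant `C_1` of the
strong rung at `ε = 1`): `ξ ≤ ξ · ∏_{q ∣ N⁻} v_q(Δ_min)` because `ξ = brandtXi ≥ 0` is a cast
natural number and the product is `≥ 1` (`one_le_prod_factorization_minimalDiscriminantNorm_freyCurve`).
[folklore] -/
theorem xiBound_of_xiStrongBound (h : XiStrongBound) : XiBound := by
  obtain ⟨C, hC⟩ := h 1 one_pos
  refine ⟨3, C, fun a b hab h0 N _ hN Nm h1 h2 h3 h4 => ?_⟩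
  have key := hC a b hab h0 N hN Nm h1 h2 h3 h4
  have hprod := one_le_prod_factorization_minimalDiscriminantNorm_freyCurve h0 hN h4
  calc (brandtXi (N / Nm) Nm (fun n => (freyCurve a b).LFunction n) : ℝ)
      ≤ (brandtXi (N / Nm) Nm (fun n => (freyCurve a b).LFunction n) : ℝ) *
          ∏ q ∈ Nm.primeFactors,
            ((((freyCurve a b).minimalDiscriminantNorm ℤ).factorization q : ℕ) : ℝ) :=
        le_mul_of_one_le_right (Nat.cast_nonneg _) hprod
    _ ≤ C * (N : ℝ) ^ (2 + (1 : ℝ)) := key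
    _ = C * (N : ℝ) ^ (3 : ℝ) := by norm_num

/-- **Given the item, the two cruxes of the route are equivalent**: `XiBoundUpgrade` supplies
`XiBound → XiStrongBound`, (B) the converse. [folklore] -/
theorem xiStrongBound_iff_xiBound (hU : XiBoundUpgrade) : XiStrongBound ↔ XiBound :=
  ⟨xiBound_of_xiStrongBound, hU⟩

/-- **Given the weak rung, the item IS the strong rung**: under `XiBound`,
`XiBoundUpgrade ↔ XiStrongBound` — the item carries the whole residual `A ↦ 2 + ε`. [folklore] -/
theorem xiBoundUpgrade_iff_xiStrongBound (hXi : XiBound) : XiBoundUpgrade ↔ XiStrongBound :=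
  ⟨fun hU => hU hXi, xiBoundUpgrade_of_xiStrongBound⟩

/-! ## (C) Logical position of a refutation -/

/-- **(C) What a disproof of the item must contain**: `¬ XiBoundUpgrade ↔ XiBound ∧ ¬ XiStrongBound` —
a proof of the (open) weak rung together with a refutation of the strong rung.  In particular the
item is not refutable before `XiBound` is proved. [folklore] -/
theorem not_xiBoundUpgrade_iff : ¬ XiBoundUpgrade ↔ XiBound ∧ ¬ XiStrongBound :=
  Classical.not_imp

/-! ## (D) `closes` reached from the weak rung + the item -/

/-- **(D₁) The thesis from the weak rung and the item**: `XiBound`, `XiBoundUpgrade`,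
`DefiniteRTControlPrime` (stmt-ABC-11338) and `FreyModularity` (stmt-ABC-11340) give
`FreyDegreeBound` (X, stmt-ABC-2019), through the PROVED glue `definiteGlue_holds` and the PROVED
`minimalBoundGivesTarget_proof`. [folklore] -/
theorem freyDegreeBound_of_xiBound_of_xiBoundUpgrade (hXi : XiBound) (hU : XiBoundUpgrade)
    (hRT : DefiniteRTControlPrime) (hMod : FreyModularity) : FreyDegreeBound :=
  minimalBoundGivesTarget_proof hMod (TwoAdicEisensteinAnchor.definiteGlue_holds (hU hXi) hRT)

/-- **(D₂) `ABC` from the weak rung and the item**: `XiStrongBound := XiBoundUpgrade XiBound` and the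
three proved supports (`DefiniteGlue`, `MinimalBoundGivesTarget`, `DegreeBoundToABCOfPetersson`); the
remaining hypotheses are the open items `DefiniteRTControlPrime`, `FreyModularity`, `PeterssonLowerBound`
(stmt-ABC-10870).  (Chained through (D₁) and `degreeBoundToABCOfPetersson_proof` rather than through the
route's deciding theorem `closes`, whose binder list changed in route rev 10–12, 2026-08-16.) [folklore] -/
theorem abc_of_xiBound_of_xiBoundUpgrade (hXi : XiBound) (hU : XiBoundUpgrade)
    (hRT : DefiniteRTControlPrime) (hMod : FreyModularity) (hP : PeterssonLowerBound) : _root_.ABC :=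
  degreeBoundToABCOfPetersson_proof hP (freyDegreeBound_of_xiBound_of_xiBoundUpgrade hXi hU hRT hMod)

/-! ## (E) The prime-level strong rung suffices for the deciding chain -/

/-- **(E₁) Prime-level glue.**  If for every `ε > 0` some `C` bounds
`ξ(E_{a,b}; N/q, q) · v_q(Δ_min) ≤ C N^{2+ε}` for all coprime `a, b` (`ab(a+b) ≠ 0`) and all ODD
PRIMES `q ∣ N` (the instances `N⁻ = q` of `XiStrongBound`), then with `DefiniteRTControlPrime`
every minimal-degree datum `D` of `E_{a,b}` at its conductor level satisfies `deg D ≤ C' N^{2+ε}` —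
verbatim the conclusion of `DefiniteGlue`.  Same proof as `definiteGlue_holds` (constants at `ε/2`,
clamped by `max · 0`; if an odd prime `q ∣ N` use it; otherwise `|a|, |b| ≤ 2` by
`prime_eq_two_of_dvd` / `natAbs_le_two` and the finitely many minimal degrees are absorbed,
`deg_le_sInf`), which used `XiStrongBound` only at `N⁻ = q`. [folklore] -/
theorem minimalDegreeBound_of_primeXiStrongBound
    (hXSq : ∀ ε : ℝ, 0 < ε → ∃ C : ℝ, ∀ a b : ℤ, IsCoprime a b → a * b * (a + b) ≠ 0 →
      ∀ (N : ℕ) [NeZero N], (freyCurve a b).conductorNorm ℤ = N → ∀ q : ℕ, q.Prime → q ≠ 2 → q ∣ N →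
        (brandtXi (N / q) q (fun n => (freyCurve a b).LFunction n) : ℝ) *
          ((((freyCurve a b).minimalDiscriminantNorm ℤ).factorization q : ℕ) : ℝ) ≤
            C * (N : ℝ) ^ (2 + ε))
    (hRT : DefiniteRTControlPrime) :
    ∀ ε : ℝ, 0 < ε → ∃ C : ℝ, ∀ a b : ℤ, IsCoprime a b → a * b * (a + b) ≠ 0 →
      ∀ (N : ℕ) [NeZero N], (freyCurve a b).conductorNorm ℤ = N →
      ∀ D : ModularParametrizationData (freyCurve a b) N,
        (∀ D' : ModularParametrizationData (freyCurve a b) N, D.deg ≤ D'.deg) →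
          (D.deg : ℝ) ≤ C * (N : ℝ) ^ (2 + ε) := by
  intro ε hε
  have hε2 : 0 < ε / 2 := by positivity
  obtain ⟨C₁, hC₁⟩ := hXSq (ε / 2) hε2
  obtain ⟨C₂, hC₂⟩ := hRT (ε / 2) hε2
  -- the finitely many curves whose conductor is a power of two are absorbed here
  set minDeg : ℤ → ℤ → ℕ := (fun a b : ℤ ↦ sInf {d : ℕ | ∃ (M : ℕ) (_ : NeZero M),
      (freyCurve a b).conductorNorm ℤ = M ∧
      ∃ D₀ : ModularParametrizationData (freyCurve a b) M, D₀.deg = d}) with hminDeg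
  refine ⟨max C₂ 0 * max C₁ 0 +
    ((∑ a ∈ Finset.Icc (-2 : ℤ) 2, ∑ b ∈ Finset.Icc (-2 : ℤ) 2, minDeg a b : ℕ) : ℝ),
    fun a b hab h0 N _ hN D hmin ↦ ?_⟩
  set Cfin : ℕ := ∑ a ∈ Finset.Icc (-2 : ℤ) 2, ∑ b ∈ Finset.Icc (-2 : ℤ) 2, minDeg a b with hCfin
  have hN1 : (1 : ℝ) ≤ (N : ℝ) := Nat.one_le_cast.mpr (Nat.one_le_iff_ne_zero.mpr (NeZero.ne N))
  have hN0 : (0 : ℝ) ≤ (N : ℝ) := Nat.cast_nonneg N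
  have hNpos : (0 : ℝ) < (N : ℝ) := one_pos.trans_le hN1
  have hNpow1 : (1 : ℝ) ≤ (N : ℝ) ^ (2 + ε) := Real.one_le_rpow hN1 (by linarith)
  have hNpow0 : (0 : ℝ) ≤ (N : ℝ) ^ (2 + ε) := zero_le_one.trans hNpow1
  have hK0 : (0 : ℝ) ≤ max C₂ 0 * max C₁ 0 := mul_nonneg (le_max_right _ _) (le_max_right _ _)
  have hCfin0 : (0 : ℝ) ≤ (Cfin : ℝ) := Nat.cast_nonneg _
  by_cases hodd : ∃ q : ℕ, q.Prime ∧ q ≠ 2 ∧ q ∣ N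
  · -- MAIN CASE: an odd prime `q ∣ N`; take `N⁻ := q`
    obtain ⟨q, hq, hq2, hqN⟩ := hodd
    have h1 := hC₂ a b hab h0 N hN q hq hq2 hqN D hmin
    have h2 := hC₁ a b hab h0 N hN q hq hq2 hqN
    have hNε : (0 : ℝ) ≤ (N : ℝ) ^ (ε / 2) := Real.rpow_nonneg hN0 _
    have hsplit : (N : ℝ) ^ (ε / 2) * (N : ℝ) ^ (2 + ε / 2) = (N : ℝ) ^ (2 + ε) := by
      rw [← Real.rpow_add hNpos]
      congr 1
      ring
    -- generic bookkeeping in the quantity `X = ξ(N/q,q) · v_q(Δ_min) ≥ 0`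
    have key : ∀ X : ℝ, 0 ≤ X → (D.deg : ℝ) ≤ C₂ * (N : ℝ) ^ (ε / 2) * X →
        X ≤ C₁ * (N : ℝ) ^ (2 + ε / 2) →
        (D.deg : ℝ) ≤ (max C₂ 0 * max C₁ 0 + (Cfin : ℝ)) * (N : ℝ) ^ (2 + ε) := by
      intro X hX0 h1 h2
      calc (D.deg : ℝ) ≤ C₂ * (N : ℝ) ^ (ε / 2) * X := h1
        _ ≤ max C₂ 0 * (N : ℝ) ^ (ε / 2) * X :=
            mul_le_mul_of_nonneg_right (mul_le_mul_of_nonneg_right (le_max_left _ _) hNε) hX0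
        _ ≤ max C₂ 0 * (N : ℝ) ^ (ε / 2) * (max C₁ 0 * (N : ℝ) ^ (2 + ε / 2)) := by
            refine mul_le_mul_of_nonneg_left ?_ (mul_nonneg (le_max_right _ _) hNε)
            exact h2.trans
              (mul_le_mul_of_nonneg_right (le_max_left _ _) (Real.rpow_nonneg hN0 _))
        _ = max C₂ 0 * max C₁ 0 * ((N : ℝ) ^ (ε / 2) * (N : ℝ) ^ (2 + ε / 2)) := by ring
        _ = max C₂ 0 * max C₁ 0 * (N : ℝ) ^ (2 + ε) := by rw [hsplit]
        _ ≤ (max C₂ 0 * max C₁ 0 + (Cfin : ℝ)) * (N : ℝ) ^ (2 + ε) := by nlinarith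
    exact key _ (by positivity) (by simpa [mul_assoc] using h1) h2
  · -- DEGENERATE CASE: `N` is a power of two; `|a|, |b| ≤ 2`
    push Not at hodd
    have hno : ∀ q : ℕ, q.Prime → q ∣ N → q = 2 := fun q hq hqN ↦ by
      by_contra hq2
      exact hodd q hq hq2 hqN
    obtain ⟨ha, hb⟩ := DefiniteXiPolyFreyDegree.natAbs_le_two hab
      (DefiniteXiPolyFreyDegree.prime_eq_two_of_dvd hab h0 hN hno)
    have hdeg : D.deg ≤ minDeg a b := by
      rw [hminDeg]; exact DefiniteXiPolyFreyDegree.deg_le_sInf hN D hmin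
    have hmem_a : a ∈ Finset.Icc (-2 : ℤ) 2 := by rw [Finset.mem_Icc]; omega
    have hmem_b : b ∈ Finset.Icc (-2 : ℤ) 2 := by rw [Finset.mem_Icc]; omega
    have hfin : minDeg a b ≤ Cfin := by
      calc minDeg a b ≤ ∑ b' ∈ Finset.Icc (-2 : ℤ) 2, minDeg a b' :=
            Finset.single_le_sum (f := fun b' ↦ minDeg a b') (fun _ _ ↦ Nat.zero_le _) hmem_b
        _ ≤ Cfin :=
            Finset.single_le_sum (f := fun a' ↦ ∑ b' ∈ Finset.Icc (-2 : ℤ) 2, minDeg a' b')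
              (fun _ _ ↦ Nat.zero_le _) hmem_a
    have hdegR : (D.deg : ℝ) ≤ (Cfin : ℝ) := by exact_mod_cast hdeg.trans hfin
    calc (D.deg : ℝ) ≤ (Cfin : ℝ) := hdegR
      _ ≤ (Cfin : ℝ) * (N : ℝ) ^ (2 + ε) := le_mul_of_one_le_right hCfin0 hNpow1
      _ ≤ (max C₂ 0 * max C₁ 0 + (Cfin : ℝ)) * (N : ℝ) ^ (2 + ε) := by nlinarith

/-- **(E₂) `ABC` from the weak rung and the PRIME-LEVEL upgrade.**  The deciding chain of the route
needs the item only in the weaker form `XiBound →` (the instances `N⁻ = q`, `q` an odd prime, of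
`XiStrongBound`): with `DefiniteRTControlPrime`, `FreyModularity`, `PeterssonLowerBound` and the proved
`minimalBoundGivesTarget_proof`, `degreeBoundToABCOfPetersson_proof`, it yields `ABC`.  So the
composite-`N⁻` instances of `XiBoundUpgrade`/`XiStrongBound` are not load-bearing for `closes`.
[folklore] -/
theorem abc_of_xiBound_of_primeUpgrade (hXi : XiBound)
    (hUq : XiBound → ∀ ε : ℝ, 0 < ε → ∃ C : ℝ, ∀ a b : ℤ, IsCoprime a b → a * b * (a + b) ≠ 0 →
      ∀ (N : ℕ) [NeZero N], (freyCurve a b).conductorNorm ℤ = N → ∀ q : ℕ, q.Prime → q ≠ 2 → q ∣ N →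
        (brandtXi (N / q) q (fun n => (freyCurve a b).LFunction n) : ℝ) *
          ((((freyCurve a b).minimalDiscriminantNorm ℤ).factorization q : ℕ) : ℝ) ≤
            C * (N : ℝ) ^ (2 + ε))
    (hRT : DefiniteRTControlPrime) (hMod : FreyModularity) (hP : PeterssonLowerBound) : _root_.ABC :=
  degreeBoundToABCOfPetersson_proof hP
    (minimalBoundGivesTarget_proof hMod (minimalDegreeBound_of_primeXiStrongBound (hUq hXi) hRT))

/-- **(E₃) The strong rung gives its prime-level instances** (specialise `N⁻ := q`: odd, squarefree,
`q.primeFactors = {q}` of odd cardinality `1`), so (E₂) is indeed no stronger than (D₂). [folklore] -/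
theorem primeXiStrongBound_of_xiStrongBound (h : XiStrongBound) :
    ∀ ε : ℝ, 0 < ε → ∃ C : ℝ, ∀ a b : ℤ, IsCoprime a b → a * b * (a + b) ≠ 0 →
      ∀ (N : ℕ) [NeZero N], (freyCurve a b).conductorNorm ℤ = N → ∀ q : ℕ, q.Prime → q ≠ 2 → q ∣ N →
        (brandtXi (N / q) q (fun n => (freyCurve a b).LFunction n) : ℝ) *
          ((((freyCurve a b).minimalDiscriminantNorm ℤ).factorization q : ℕ) : ℝ) ≤
            C * (N : ℝ) ^ (2 + ε) := by
  intro ε hε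
  obtain ⟨C, hC⟩ := h ε hε
  refine ⟨C, fun a b hab h0 N _ hN q hq hq2 hqN => ?_⟩
  have h2 := hC a b hab h0 N hN q (hq.odd_of_ne_two hq2) hq.prime.squarefree
    (by rw [hq.primeFactors, Finset.card_singleton]; exact odd_one) hqN
  rwa [hq.primeFactors, Finset.prod_singleton] at h2

/-! ## (G) The two events that close the item -/

/-- **(G₁)** A refutation of the weak rung closes the item vacuously. [folklore] -/
theorem xiBoundUpgrade_of_not_xiBound (h : ¬ XiBound) : XiBoundUpgrade := fun hXi => absurd hXi h

/-- **(G₂)** `XiBoundUpgrade ↔ ¬ XiBound ∨ XiStrongBound`: the item closes exactly when stmt-ABC-11336 is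
refuted or stmt-ABC-11337 is proved (directly, or through the rev-12 pair `EisensteinQuarantine ∧
SteinbergCore`, which gives `XiStrongBound` by the algebra inlined in `closes`). [folklore] -/
theorem xiBoundUpgrade_iff_not_xiBound_or_xiStrongBound :
    XiBoundUpgrade ↔ ¬ XiBound ∨ XiStrongBound :=
  imp_iff_not_or

/-- **(G₃)** If the strong rung is refuted, the item becomes the negation of the weak rung. [folklore] -/
theorem xiBoundUpgrade_iff_not_xiBound_of_not_xiStrongBound (h : ¬ XiStrongBound) :
    XiBoundUpgrade ↔ ¬ XiBound :=
  ⟨fun hU hXi => h (hU hXi), xiBoundUpgrade_of_not_xiBound⟩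

/-! ## (I) The item from the rev-12 binders `EisensteinQuarantine ∧ SteinbergCore`

Since route rev 12 (2026-08-16) `closes` takes neither `XiStrongBound` nor `XiBound` nor this item: it takes
the NEW cruxes `EisensteinQuarantine` (stmt-ABC-15023, abc-free) and `SteinbergCore` (stmt-ABC-15024,
abc-strength) and derives `XiStrongBound` INSIDE its proof term, where no file can cite it.  (I₁) extracts
that algebra over the route decls; (I₂) is the third closing event of the item (besides (G)); (I₃) names the
residual in rev-12 vocabulary: given the abc-free binder, the item follows from `XiBound → SteinbergCore`. -/

/-- **(I₁) `EisensteinQuarantine → SteinbergCore → XiStrongBound`** (the algebra inlined in `closes`, route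
rev 12, as a citable theorem): with `ξ = brandtXi (N/N⁻) N⁻ (a_n(E_{a,b}))`, `s := ordProj[2] ξ · ordProj[3] ξ`
(the `{2,3}`-part, `s ∣ ξ` since `2^{v₂ξ}` and `3^{v₃ξ}` are coprime divisors), `ξ = s · (ξ / s)`, and
`∏_{q ∣ N} v_q(Δ_min) = (∏_{q ∣ N, q ∤ N⁻} v_q) · ∏_{q ∣ N⁻} v_q` (`Finset.prod_sdiff`, `N⁻ ∣ N`), the binders
taken at `ε/2` (constants replaced by `max · 0`) multiply to
`ξ · ∏_{q ∣ N⁻} v_q ≤ (C₁ N^{ε/2} ∏_{q ∤ N⁻} v_q) · (ξ/s) · ∏_{q ∣ N⁻} v_q = C₁ N^{ε/2} · ((ξ/s) · ∏_{q ∣ N} v_q)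
≤ C₁ C₂ N^{2+ε}`. [folklore] -/
theorem xiStrongBound_of_eisensteinQuarantine_of_steinbergCore (hEis : EisensteinQuarantine)
    (hCore : SteinbergCore) : XiStrongBound := by
  intro ε hε
  obtain ⟨C₁, hC₁⟩ := hEis (ε / 2) (by linarith)
  obtain ⟨C₂, hC₂⟩ := hCore (ε / 2) (by linarith)
  refine ⟨max C₁ 0 * max C₂ 0, ?_⟩
  intro a b hab h0 N _ hN Nm hodd hsq hcard hdvd
  have hA' := hC₁ a b hab h0 N hN Nm hodd hsq hcard hdvd
  have hB' := hC₂ a b hab h0 N hN Nm hodd hsq hcard hdvd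
  set ξ : ℕ := brandtXi (N / Nm) Nm (fun n => (freyCurve a b).LFunction n) with hξ
  set s : ℕ := ordProj[2] ξ * ordProj[3] ξ with hs
  set v : ℕ → ℕ := fun q => ((freyCurve a b).minimalDiscriminantNorm ℤ).factorization q with hv
  have hNpos : (0 : ℝ) < (N : ℝ) := by exact_mod_cast Nat.pos_of_ne_zero (NeZero.ne N)
  have hsub : Nm.primeFactors ⊆ N.primeFactors := Nat.primeFactors_mono hdvd (NeZero.ne N)
  -- the `{2,3}`-part divides `ξ`, hence `ξ = s * (ξ / s)`
  have hsdvd : s ∣ ξ := by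
    rcases Nat.eq_zero_or_pos ξ with h0ξ | _
    · rw [h0ξ]; exact dvd_zero _
    · exact Nat.Coprime.mul_dvd_of_dvd_of_dvd
        (Nat.Coprime.pow _ _ (by norm_num : Nat.Coprime 2 3)) (Nat.ordProj_dvd ξ 2) (Nat.ordProj_dvd ξ 3)
  have hsc : (ξ : ℝ) = (s : ℝ) * ((ξ / s : ℕ) : ℝ) := by
    have : s * (ξ / s) = ξ := Nat.mul_div_cancel' hsdvd
    exact_mod_cast this.symm
  -- `∏_{q ∣ N} v_q = ∏_{q ∣ N, q ∤ Nm} v_q * ∏_{q ∣ Nm} v_q`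
  have hprod : ((∏ q ∈ N.primeFactors, v q : ℕ) : ℝ)
      = ((∏ q ∈ N.primeFactors \ Nm.primeFactors, v q : ℕ) : ℝ) * ∏ q ∈ Nm.primeFactors, ((v q : ℕ) : ℝ) := by
    rw [← Nat.cast_prod, ← Nat.cast_mul, Finset.prod_sdiff hsub]
  have hL : (0 : ℝ) ≤ ((∏ q ∈ N.primeFactors \ Nm.primeFactors, v q : ℕ) : ℝ) := by positivity
  have hM : (0 : ℝ) ≤ ∏ q ∈ Nm.primeFactors, ((v q : ℕ) : ℝ) := by positivity
  have hc : (0 : ℝ) ≤ ((ξ / s : ℕ) : ℝ) := by positivity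
  have hrpow1 : (0 : ℝ) ≤ (N : ℝ) ^ (ε / 2) := Real.rpow_nonneg hNpos.le _
  have hrpow2 : (0 : ℝ) ≤ (N : ℝ) ^ (2 + ε / 2) := Real.rpow_nonneg hNpos.le _
  have hC₁0 : (0 : ℝ) ≤ max C₁ 0 := le_max_right _ _
  have hC₂0 : (0 : ℝ) ≤ max C₂ 0 := le_max_right _ _
  have hA'' : (s : ℝ) ≤ max C₁ 0 * (N : ℝ) ^ (ε / 2) *
      ((∏ q ∈ N.primeFactors \ Nm.primeFactors, v q : ℕ) : ℝ) := by
    refine le_trans hA' ?_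
    gcongr
    exact le_max_left _ _
  have hB'' : ((ξ / s : ℕ) : ℝ) * ((∏ q ∈ N.primeFactors, v q : ℕ) : ℝ) ≤
      max C₂ 0 * (N : ℝ) ^ (2 + ε / 2) := by
    refine le_trans hB' ?_
    gcongr
    exact le_max_left _ _
  have hNsplit : (N : ℝ) ^ (ε / 2) * (N : ℝ) ^ (2 + ε / 2) = (N : ℝ) ^ (2 + ε) := by
    rw [← Real.rpow_add hNpos]; ring_nf
  calc (ξ : ℝ) * ∏ q ∈ Nm.primeFactors, ((v q : ℕ) : ℝ)
      = (s : ℝ) * (((ξ / s : ℕ) : ℝ) * ∏ q ∈ Nm.primeFactors, ((v q : ℕ) : ℝ)) := by rw [hsc]; ring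
    _ ≤ (max C₁ 0 * (N : ℝ) ^ (ε / 2) * ((∏ q ∈ N.primeFactors \ Nm.primeFactors, v q : ℕ) : ℝ))
          * (((ξ / s : ℕ) : ℝ) * ∏ q ∈ Nm.primeFactors, ((v q : ℕ) : ℝ)) := by
        gcongr
    _ = max C₁ 0 * (N : ℝ) ^ (ε / 2) * (((ξ / s : ℕ) : ℝ) * ((∏ q ∈ N.primeFactors, v q : ℕ) : ℝ)) := by
        rw [hprod]; ring
    _ ≤ max C₁ 0 * (N : ℝ) ^ (ε / 2) * (max C₂ 0 * (N : ℝ) ^ (2 + ε / 2)) := by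
        gcongr
    _ = max C₁ 0 * max C₂ 0 * (N : ℝ) ^ (2 + ε) := by rw [← hNsplit]; ring

/-- **(I₂) The rev-12 binders close the item**: `EisensteinQuarantine → SteinbergCore → XiBoundUpgrade`
(the third closing event besides (G): stmt-ABC-15023 ∧ stmt-ABC-15024). [folklore] -/
theorem xiBoundUpgrade_of_eisensteinQuarantine_of_steinbergCore (hEis : EisensteinQuarantine)
    (hCore : SteinbergCore) : XiBoundUpgrade :=
  xiBoundUpgrade_of_xiStrongBound (xiStrongBound_of_eisensteinQuarantine_of_steinbergCore hEis hCore)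

/-- **(I₃) The residual in rev-12 vocabulary**: given the abc-FREE binder `EisensteinQuarantine`, the item
follows from the weak-rung-conditional Steinberg core `XiBound → SteinbergCore` — what separates the weak
rung from the item is (at most) the abc-strength binder under the weak rung. [folklore] -/
theorem xiBoundUpgrade_of_eisensteinQuarantine_of_imp (hEis : EisensteinQuarantine)
    (hCore : XiBound → SteinbergCore) : XiBoundUpgrade := fun hXi =>
  xiStrongBound_of_eisensteinQuarantine_of_steinbergCore hEis (hCore hXi)

end Summit.ABC.ABC.Theorems.DefiniteXiXiBoundUpgrade

end
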